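import Literature.AlgebraicGeometry.Motives.GrassmannianQuotientOfFreeModule
import Literature.AlgebraicGeometry.Modules.PullbackFrame
import Literature.AlgebraicGeometry.Modules.PullbackFlatMono
import HarnessLib

/-!
# A frame `𝒪^ι ≅ N|_⊤` from an isomorphism `𝒪_S^{(ι)} ⥲ N`, with its basis sections — and the base-changed form

Topic `AlgebraicGeometry/Modules`; namespace `Literature.AlgebraicGeometry.Modules`.  THEOREMS ONLY (no definition, no named
fact, no instance, no notation, no `sorry`).  Cell `hodgecm-mathlib` (D-0151), cut (s1) of the (H-rep) file of the F-6 → F-8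
hand-over (B-p18 (g19) 2026-08-30 10:18:46Z): [MumfordFogartyKirwan1994] Ch. 7 §2 Prop. 7.3 step (VI) makes
`H⁰(ℙ^m, 𝒪(1)) ⊗ 𝒪_H → π_*(𝒪(1)|_{Z_H})` an ISOMORPHISM of `𝒪_H`-modules — in the tree a morphism
`u : freeModule H ι ⟶ π_*G` with `IsIso u` (or, after a base change `k`, `IsIso (k^*u ≫ β)` with `β` the base-change map of
the direct image) — while the frame-embedding files (★ (8α) `IsFrameRigidification`, ★ `Morphisms/ProjectiveOfPushforwardFrame`,
★ `Morphisms/PushforwardFrameBaseChange`) take a FRAME `e : SheafOfModules.free ι ≅ (π_*G).over ⊤` and read its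
`basisSection e j`.  This file is the bridge, with the section identities the consumer needs.  Count-neutral: HC_CM is
proved only modulo the 7 printed citations until rung 0 closes — nothing here bears on a summit statement.

* **`exists_frame_basisSection_eq_app_of_isIso`** — an isomorphism `u : 𝒪_S^{(ι)} ⟶ N` gives a frame `e : 𝒪^ι ≅ N|_⊤` whose
  basis sections are the images `u(ε_j)` of the tautological sections (★ `freeModuleFrame` moved across `u`; ★
  `basisSection_freeModuleFrame`).
* **`exists_frame_basisSection_eq_app_unitSectionLE_of_isIso`** — the base-changed form: for `u : 𝒪_S^{(ι)} ⟶ N`, `k : S′ → S`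
  and `β : k^*N ⟶ N′` with `k^*u ≫ β` an isomorphism, a frame `e′ : 𝒪^ι ≅ N′|_⊤` whose basis sections are
  `β(η_k(u(ε_j)))` (★ `pullbackFrame`, ★ `basisSection_pullbackFrame`, naturality ★ `pullback_map_app_unitSection`).

## References
* [Hartshorne1977] R. Hartshorne, *Algebraic Geometry* (1977), II §5 (pp. 109–110).
* [MumfordFogartyKirwan1994] D. Mumford, J. Fogarty, F. Kirwan, *Geometric Invariant Theory*, 3rd ed. (1994), Ch. 7 §2 Prop. 7.3,
  step (VI) of the proof (p. 134).
-/

noncomputable section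

-- Mathlib's `Scheme.Modules` section API is stated across semireducible wrappers (as in ★ `Modules/PullbackFrame`).
set_option backward.isDefEq.respectTransparency false

open CategoryTheory CategoryTheory.Limits AlgebraicGeometry Opposite TopologicalSpace
open Literature.AlgebraicGeometry.Motives

universe u

namespace Literature.AlgebraicGeometry.Modules

/-- Basis sections of a frame moved across an isomorphism of modules are the images of the basis sections (★
`basisSection_isoFrame`, restated to keep this file's imports inside `Modules/` + `Motives/Grassmannian*`). [folklore] -/
private theorem basisSection_trans_overFunctor_mapIso {X : Scheme.{u}} {E E' : X.Modules} {W : X.Opens} {I : Type u}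
    (e : SheafOfModules.free I ≅ E.over W) (φ : E ≅ E') (i : I) :
    basisSection (e ≪≫ (SheafOfModules.overFunctor _ W).mapIso φ) i = φ.hom.app W (basisSection e i) := by
  rw [basisSection, basisSection, Iso.trans_hom, SheafOfModules.freeHomEquiv_comp_apply,
    overSectionsEquiv_sectionsMap', Functor.mapIso_hom, appLE_over_map]

/-- **A frame from an isomorphism `u : 𝒪_S^{(ι)} ⥲ N`, with basis sections `u(ε_j)`**: there is
`e : SheafOfModules.free ι ≅ N.over ⊤` with `basisSection e j = u(ε_j)` for every `j` — the global frame ★ `freeModuleFrame S ι ⊤`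
of the free module followed by `u|_⊤`.  At `N := π_*G` this turns [MumfordFogartyKirwan1994] Prop. 7.3 (VI) («`H⁰(𝒪(1)) ⊗ 𝒪_H ⥲ π_*𝒪(1)`»)
into the frame the embedding files read. [cite: Hartshorne1977, II §5 (p. 109)]
[cite: MumfordFogartyKirwan1994, Ch. 7 §2 Prop. 7.3, step (VI) of the proof (p. 134)] -/
theorem exists_frame_basisSection_eq_app_of_isIso {S : Scheme.{u}} {ι : Type u} {N : S.Modules}
    (u : freeModule S ι ⟶ N) [IsIso u] :
    ∃ e : SheafOfModules.free ι ≅ N.over ⊤, ∀ j, basisSection e j = u.app ⊤ (freeSectionOn S j ⊤) := by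
  refine ⟨freeModuleFrame S ι ⊤ ≪≫ (SheafOfModules.overFunctor _ ⊤).mapIso (asIso u : freeModule S ι ≅ N), fun j ↦ ?_⟩
  rw [basisSection_trans_overFunctor_mapIso, basisSection_freeModuleFrame]
  rfl

/-- **The base-changed form**: for `u : 𝒪_S^{(ι)} ⟶ N`, a morphism `k : S′ → S`, and `β : k^*N ⟶ N′` with `k^*u ≫ β` an
isomorphism (`ι` finite), there is a frame `e′ : SheafOfModules.free ι ≅ N′.over ⊤` whose basis sections are `β(η_k(u(ε_j)))` (the pulled-back
frame ★ `pullbackFrame k (freeModuleFrame S ι ⊤)` of `k^*𝒪_S^{(ι)}` restricted to `⊤`, basis sections `η_k(ε_j)|_⊤`, moved across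
`k^*u ≫ β`; naturality of `η_k`, ★ `pullback_map_app_unitSectionLE`).  At `N := π_*G`, `β :=` the base-change map of the direct image, this is [MumfordFogartyKirwan1994] Prop. 7.3 (VI) read
over a `T`-valued point of `H`. [cite: Hartshorne1977, II §5 (p. 110)]
[cite: MumfordFogartyKirwan1994, Ch. 7 §2 Prop. 7.3, step (VI) of the proof (p. 134)] -/
theorem exists_frame_basisSection_eq_app_unitSectionLE_of_isIso {S S' : Scheme.{u}} {ι : Type u} [Fintype ι] {N : S.Modules}
    (u : freeModule S ι ⟶ N) (k : S' ⟶ S) {N' : S'.Modules} (β : (Scheme.Modules.pullback k).obj N ⟶ N')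
    [IsIso ((Scheme.Modules.pullback k).map u ≫ β)] :
    ∃ e' : SheafOfModules.free ι ≅ N'.over ⊤, ∀ j,
      basisSection e' j = β.app ⊤ (unitSectionLE k N (V := ⊤) (U := ⊤) le_top (u.app ⊤ (freeSectionOn S j ⊤))) := by
  -- the pulled-back frame of `k^*𝒪_S^{(ι)}` over `k⁻¹⊤`, restricted to `⊤`, then moved across `k^*u ≫ β`
  let e₀ : SheafOfModules.free ι ≅ ((Scheme.Modules.pullback k).obj (freeModule S ι)).over (k ⁻¹ᵁ ⊤) :=
    pullbackFrame k (freeModuleFrame S ι ⊤)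
  let e₁ : SheafOfModules.free ι ≅ ((Scheme.Modules.pullback k).obj (freeModule S ι)).over ⊤ :=
    SheafOfModules.restrictTrivialisation (R := S'.ringCatSheaf) (homOfLE (le_top : (⊤ : S'.Opens) ≤ k ⁻¹ᵁ ⊤)) e₀
  let φ : (Scheme.Modules.pullback k).obj (freeModule S ι) ≅ N' := asIso ((Scheme.Modules.pullback k).map u ≫ β)
  refine ⟨e₁ ≪≫ (SheafOfModules.overFunctor _ ⊤).mapIso φ, fun j ↦ ?_⟩
  have h₁ : basisSection e₁ j = unitSectionLE k (freeModule S ι) (V := ⊤) (U := ⊤) le_top (freeSectionOn S j ⊤) := by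
    show basisSection (SheafOfModules.restrictTrivialisation (R := S'.ringCatSheaf) (homOfLE _) e₀) j = _
    rw [basisSection_restrictTrivialisation, show e₀ = pullbackFrame k (freeModuleFrame S ι ⊤) from rfl,
      basisSection_pullbackFrame, basisSection_freeModuleFrame]
    rfl
  rw [basisSection_trans_overFunctor_mapIso, h₁]
  change β.app ⊤ (((Scheme.Modules.pullback k).map u).app ⊤
    (unitSectionLE k (freeModule S ι) (V := ⊤) (U := ⊤) le_top (freeSectionOn S j ⊤))) = _
  rw [pullback_map_app_unitSectionLE]

end Literature.AlgebraicGeometry.Modules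

end
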